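import Mathlib.Data.Real.Basic
import Mathlib.Data.Rat.Defs
import Mathlib.Algebra.Order.Field.Basic
import Mathlib.Tactic.Linarith
import Mathlib.Tactic.Positivity
import Mathlib.Tactic.FieldSimp
import Mathlib.Tactic.Ring
import Mathlib.Tactic.NormNum
import HarnessLib

/-!
# Volkov 2020 (NPB 961, 115232) §1 — the printed toy integral for «IR and UV divergences can occur in a mixed form», f(λ,Λ) = ∫_λ^Λ∫_λ^Λ dxdy/(x⁴y²+1): its integrand is within a factor 2 of the monomial maximum min(1, x⁻⁴y⁻²), and the resulting RAY EXPONENT E(a,b) = a − b + max(0, 2b − 4a) on (x,y) = (λ^a, λ^{−b}) is positive on both coordinate rays, negative exactly on the open cone a < b < 3a, and minimal on the kink ray b = 2a of the integrand's tropical fan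

independent recomputation; certified where stated, statistical where stated; no new-physics claim.

CITATION HEADER (venture `QEDPrecision`, cell `pub-qed`, track TROPICAL seat V3b = `pub-qed-trop-v3-lit-2` gen 6; VALUE-FREE: a two-variable calculus
toy printed by the source; nothing per graph or word). Fourth `Volkov2020` companion (after `UVDegreeHandshake`, `SpeerFormHalf`, `DenominatorLemmaArithmetic`);
serves `tropical/view/V3-VOLKOV-DEGREES.md` §B.1's quotation of the «mixed form» passage and the track's ray-census vocabulary (E on rays, fan refinement,
kink generators: `tropical/theory/T1-EXPONENTS.md` §5, `tropical/theory/T3-PAIRING.md` §14 Lemma S).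

Source. [Volkov2020] S. Volkov, Nucl. Phys. B 961 (2020) 115232 = arXiv:1912.04885v4, §1 (journal p.4; e-print tex l.103–109): "All UV divergences in the
Schwinger parametric integral (1.2) can be recognized by taking z_{j₁} = z_{j₂} = … = z_{j_l} = δ and calculating the leading power of δ in the limit δ → 0.
However, this statement is wrong for IR divergences in Feynman parametric integrals even for constant-sign W(z,p). For example, sometimes a substitution
of the form z_{j₁} = … = z_{j_l} = δ, z_{j_{l+1}} = … = z_{j_q} = δ² is required; see [Kinoshita]. Also, IR and UV divergences can occur in a mixed form.
This can be illustrated by the simple integral f(λ,Λ) = ∫_λ^Λ dxdy/(x⁴y²+1), 0 < λ < Λ. It is easy to see that lim_{λ→0} f(λ,Λ) is finite for any fixed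
Λ as well as lim_{Λ→+∞} f(λ,Λ) is finite for any fixed λ > 0. However, the simultaneous limit lim_{λ→0,Λ→+∞} f(λ,Λ) is infinite [fn: The integral over
the domain {x ≥ λ; y > 0} equals C∫_λ^{+∞} dx/x² = C/λ, where C = ∫₀^{+∞} dt/(t²+1), but over {x > 0; y ≤ Λ} it equals C∫₀^Λ dx/√x = 2C√Λ, where
C = ∫₀^{+∞} dt/(t⁴+1).]"

What the kernel certifies.
* `toy_integrand_two_sided` — for x, y > 0: ½·min(1, (x⁴y²)⁻¹) ≤ 1/(x⁴y²+1) ≤ min(1, (x⁴y²)⁻¹): the printed integrand is comparable, with constants ½ and 1,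
  to the maximum-monomial form min(1, x⁻⁴y⁻²) — so its size on every dyadic box is that of a monomial, and ray exponents decide convergence box-wise.
* DERIVED OBJECT (V3b's reading, stated as a definition so that it can be cited and attacked): on the two-parameter family of directions
  (x, y) = (λ^a, λ^{−b}), λ → 0, a, b ≥ 0 (a > 0: x → 0, the «IR» side of the toy; b > 0: y → +∞, its «UV» side), the dyadic box at (x, y) carries
  measure ≍ x·y = λ^{a−b} and integrand ≍ min(1, λ^{2b−4a}); `toyE a b := a − b + max 0 (2b − 4a)` is the resulting λ-exponent of (box measure × integrand)
  (rational arithmetic; E > 0 along a ray = geometric decay of the box contributions, E < 0 = geometric growth, E = 0 = marginal).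
* `toyE_of_le_kink` / `toyE_of_ge_kink` — E is linear on each of the two cones b ≤ 2a (E = a − b) and b ≥ 2a (E = b − 3a) cut out by the KINK RAY b = 2a
  (where x⁴y² ≍ 1: the tropical hypersurface of the denominator x⁴y² + 1);
* `toyE_axis_x` / `toyE_axis_y` — on the coordinate rays E(a,0) = a > 0 and E(0,b) = b > 0: «lim_{λ→0} f finite for fixed Λ», «lim_{Λ→∞} f finite for
  fixed λ» — each single limit is fine;
* `toyE_neg_iff` — for a > 0: E(a,b) < 0 ⇔ a < b < 3a: an OPEN CONE of divergent mixed directions strictly inside the quadrant, invisible from both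
  axes («the simultaneous limit … is infinite», power-like as in the footnote's C/λ); `toyE_diag` (E(1,1) = 0) and `toyE_one_three` (E(1,3) = 0) are its
  two marginal boundary rays, `toyE_kink` (E(1,2) = −1) its most divergent one;
* `toyE_min_on_simplex` — normalising a + b = 1: E ≥ −1/3 with equality at (a,b) = (1/3, 2/3) (`toyE_kink_normalised`), i.e. the minimum of E
  over all directions sits on the kink ray b = 2a and NOT at a generator (1,0), (0,1) of the quadrant — refining the quadrant by the kink ray makes E
  linear on each cone, after which checking generators suffices (the fan-refinement / «kink generator» point of T1 §5.3 and T3 §14, on the source's own toy).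
NOT claimed: the values of the integrals (the footnote's C/λ and 2C√Λ), any measure-theoretic statement, anything about Feynman integrands.
-/

namespace Literature.MathematicalPhysics.QuantumFieldTheory.Volkov2020

/-! ## The printed integrand vs. its monomial maximum -/

/-- For x, y > 0: ½·min(1, (x⁴y²)⁻¹) ≤ 1/(x⁴y² + 1) ≤ min(1, (x⁴y²)⁻¹). [cite: Volkov2020, §1, the integral f(λ,Λ) = ∫∫ dxdy/(x⁴y²+1) (journal p.4; tex l.107)] -/
theorem toy_integrand_two_sided (x y : ℝ) (hx : 0 < x) (hy : 0 < y) :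
    min 1 (x ^ 4 * y ^ 2)⁻¹ / 2 ≤ 1 / (x ^ 4 * y ^ 2 + 1) ∧ 1 / (x ^ 4 * y ^ 2 + 1) ≤ min 1 (x ^ 4 * y ^ 2)⁻¹ := by
  set u : ℝ := x ^ 4 * y ^ 2 with hu
  have hu0 : 0 < u := by positivity
  have hu1 : 0 < u + 1 := by positivity
  refine ⟨?_, ?_⟩
  · -- lower: min(1, 1/u)/2 ≤ 1/(u+1), since u + 1 ≤ 2·max(u, 1)
    rw [div_le_iff₀ (by norm_num : (0:ℝ) < 2)]
    rcases le_total u 1 with h | h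
    · -- u ≤ 1: min = 1 branch bound: 1 ≤ 2/(u+1)
      calc min 1 u⁻¹ ≤ 1 := min_le_left _ _
        _ ≤ 1 / (u + 1) * 2 := by rw [div_mul_eq_mul_div, le_div_iff₀ hu1]; linarith
    · -- 1 ≤ u: min ≤ 1/u ≤ 2/(u+1)
      calc min 1 u⁻¹ ≤ u⁻¹ := min_le_right _ _
        _ ≤ 1 / (u + 1) * 2 := by
            rw [div_mul_eq_mul_div, inv_eq_one_div, div_le_div_iff₀ hu0 hu1]; linarith
  · -- upper: 1/(u+1) ≤ 1 and ≤ 1/u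
    refine le_min ?_ ?_
    · rw [div_le_one hu1]; linarith
    · rw [inv_eq_one_div]; exact div_le_div_of_nonneg_left (by norm_num) hu0 (by linarith)

/-! ## The ray exponent (derived object) -/

/-- V3b's DERIVED ray exponent of the printed toy: along (x, y) = (λ^a, λ^{−b}), λ → 0, the dyadic box at (x,y) contributes ≍ λ^{E(a,b)} with
E(a,b) = (a − b) + max(0, 2b − 4a) (box measure x·y = λ^{a−b}; integrand ≍ min(1, (x⁴y²)⁻¹) = λ^{max(0, 2b−4a)} by `toy_integrand_two_sided`).
[cite: Volkov2020, §1 toy integral (journal p.4); the exponent bookkeeping is this file's reading, not printed] -/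
def toyE (a b : ℚ) : ℚ := a - b + max 0 (2 * b - 4 * a)

/-- Unfolding lemma for `toyE`. [cite: Volkov2020, §1 toy integral (journal p.4); derived exponent, see `toyE`] -/
theorem toyE_def (a b : ℚ) : toyE a b = a - b + max 0 (2 * b - 4 * a) := rfl

/-- On the cone b ≤ 2a (x⁴y² → 0 or bounded: integrand ≍ 1): E = a − b. [cite: Volkov2020, §1 toy integral (journal p.4)] -/
theorem toyE_of_le_kink {a b : ℚ} (h : b ≤ 2 * a) : toyE a b = a - b := by
  unfold toyE; rw [max_eq_left (by linarith)]; ring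

/-- On the cone b ≥ 2a (x⁴y² → ∞: integrand ≍ x⁻⁴y⁻²): E = b − 3a. [cite: Volkov2020, §1 toy integral (journal p.4)] -/
theorem toyE_of_ge_kink {a b : ℚ} (h : 2 * a ≤ b) : toyE a b = b - 3 * a := by
  unfold toyE; rw [max_eq_right (by linarith)]; ring

/-- Pure «IR» ray (x → 0, y fixed): E(a, 0) = a, positive for a > 0 — «lim_{λ→0} f(λ,Λ) is finite for any fixed Λ». [cite: Volkov2020, §1 (journal p.4)] -/
theorem toyE_axis_x {a : ℚ} (ha : 0 ≤ a) : toyE a 0 = a := by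
  rw [toyE_of_le_kink (by linarith)]; ring

/-- Pure «UV» ray (y → ∞, x fixed): E(0, b) = b, positive for b > 0 — «lim_{Λ→+∞} f(λ,Λ) is finite for any fixed λ > 0». [cite: Volkov2020, §1 (journal p.4)] -/
theorem toyE_axis_y {b : ℚ} (hb : 0 ≤ b) : toyE 0 b = b := by
  rw [toyE_of_ge_kink (by linarith)]; ring

/-- The divergent directions: for a > 0, E(a,b) < 0 ⇔ a < b < 3a — an open cone strictly inside the quadrant, met by neither axis («the simultaneous
limit … is infinite»). [cite: Volkov2020, §1 (journal p.4)] -/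
theorem toyE_neg_iff {a b : ℚ} (ha : 0 < a) : toyE a b < 0 ↔ a < b ∧ b < 3 * a := by
  rcases le_total b (2 * a) with h | h
  · rw [toyE_of_le_kink h]; constructor
    · intro hlt; exact ⟨by linarith, by linarith⟩
    · rintro ⟨h1, _⟩; linarith
  · rw [toyE_of_ge_kink h]; constructor
    · intro hlt; exact ⟨by linarith, by linarith⟩
    · rintro ⟨_, h2⟩; linarith

/-- The marginal boundary ray b = a (x ~ λ, y ~ 1/λ): E = 0. [cite: Volkov2020, §1 (journal p.4)] -/
theorem toyE_diag : toyE 1 1 = 0 := by rw [toyE_of_le_kink (by norm_num)]; norm_num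

/-- The other marginal boundary ray b = 3a: E = 0. [cite: Volkov2020, §1 (journal p.4)] -/
theorem toyE_one_three : toyE 1 3 = 0 := by rw [toyE_of_ge_kink (by norm_num)]; norm_num

/-- The kink ray b = 2a (x⁴y² ≍ 1, the tropical hypersurface of x⁴y² + 1): E(1,2) = −1, the most divergent direction. [cite: Volkov2020, §1 (journal p.4)] -/
theorem toyE_kink : toyE 1 2 = -1 := by rw [toyE_of_le_kink (by norm_num)]; norm_num

/-- Normalised directions a + b = 1 (in particular all a, b ≥ 0 with a + b = 1): E ≥ −1/3. [cite: Volkov2020, §1 (journal p.4)] -/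
theorem toyE_min_on_simplex {a b : ℚ} (h : a + b = 1) : -1 / 3 ≤ toyE a b := by
  rcases le_total b (2 * a) with hk | hk
  · rw [toyE_of_le_kink hk]; linarith
  · rw [toyE_of_ge_kink hk]; linarith

/-- … with equality exactly on the kink ray: E(1/3, 2/3) = −1/3 — the minimum over directions is attained on the ray b = 2a that refines the quadrant
into the two linearity cones of E, not at the quadrant's generators (1,0), (0,1) where E = 1 > 0. [cite: Volkov2020, §1 (journal p.4)] -/
theorem toyE_kink_normalised : toyE (1 / 3) (2 / 3) = -1 / 3 := by
  rw [toyE_of_le_kink (by norm_num)]; norm_num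

/-- The generators of the unrefined quadrant both have E = 1 > 0 while an interior direction has E < 0: checking a cone's generators decides the sign
of E on the cone only after refining by the kink ray (on each refined cone E is linear, `toyE_of_le_kink` / `toyE_of_ge_kink`).
[cite: Volkov2020, §1 (journal p.4)] -/
theorem toyE_generators_do_not_decide : toyE 1 0 = 1 ∧ toyE 0 1 = 1 ∧ toyE 1 2 < 0 := by
  refine ⟨toyE_axis_x (by norm_num), toyE_axis_y (by norm_num), ?_⟩
  rw [toyE_kink]; norm_num

end Literature.MathematicalPhysics.QuantumFieldTheory.Volkov2020
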